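import Mathlib.RingTheory.MvPolynomial.Homogeneous
import Mathlib.Algebra.MvPolynomial.Monad
import Mathlib.Algebra.MvPolynomial.PDeriv
import Mathlib.Data.Fin.VecNotation
import Mathlib.Tactic.LinearCombination
import Mathlib.Tactic.Ring
import Summits.ResolutionOfSingularities.ResolutionOfSingularities.Theorems.FrobeniusClosingSteerOddAnisotropicNoAlmostPower

/-!
# Translation-invariant binary forms are powers of the invariant linear form (K-β7 block (e-alg); W4.1, OURS)

Kernel block (e-alg) of the K-β7 plan (`FormalCentreDescent`, β-slot hβ6′ of the W4.1 leaf; memo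
`CANONICAL-CLEANING-g10.md` §11 SUBLEMMA and §12.3 step (4) of res-L0-w41-idea-1): over ANY field `K`
(any characteristic), a binary form `Φ(Z, W)` of degree `e` which is invariant under the translation by a
non-zero vector `t = (t₁, t₂)`, i.e. `Φ(Z + t₁, W + t₂) = Φ(Z, W)` as polynomials, is `c·(t₂ Z − t₁ W)^e`.

Proof (memo §11, «compare `W`-degrees after moving `t` to `(τ, 0)`»). If `t₁ ≠ 0`, the shear
`A : Z ↦ t₁ Z, W ↦ t₂ Z + W` (so `A e₁ = t`) turns the hypothesis into `g(Z + 1, W) = g(Z, W)` for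
`g := Φ ∘ A`, homogeneous of degree `e`; killing `Z` gives `g(1, W) = g(0, W) = g₀ W^e`, and dehomogenisation
is injective on forms of a fixed degree, so `g = g₀ W^e`; undoing the shear, `Φ = g₀ (−1/t₁)^e (t₂ Z − t₁ W)^e`.
If `t₁ = 0` the variables are swapped. Homogeneity is what makes the statement true in positive
characteristic (the non-homogeneous Artin–Schreier polynomial `Z^p − Z` is invariant under `Z ↦ Z + 1`).

CLOSER for memo §12.3 step (4) (`false_of_pderiv_translation_invariant`, on top of block (f)
`…SteerOddAnisotropicNoAlmostPower`): if `Ψ ∈ κ[Z, W]` is anisotropic over `κ` of characteristic `2`, of odd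
degree `d`, and over some extension field `L` BOTH partial derivatives of `Ψ ⊗ L` are invariant under the
translation by a non-zero vector `t ∈ L²` (which is what the Hasse expansion along a second formal branch
produces), then `False`: by the sublemma `∂_Z Ψ = α ℓ_t^{d-1}`, `∂_W Ψ = β ℓ_t^{d-1}`, and block (f) applies.

Everything here is OURS (the run's own bookkeeping), AI-written and AI-checked only — weaker than expert
review; nothing is a statement of [Hironaka2017]. -/

set_option linter.dupNamespace false
set_option autoImplicit false

namespace Summit.ResolutionOfSingularities.ResolutionOfSingularities.Theorems.SwitchingDichotomy.TranslationInvariant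

open MvPolynomial

variable {K : Type*} [Field K]

/-- A substitution of variables by LINEAR FORMS preserves homogeneity and degree. -/
theorem isHomogeneous_bind₁_linear {e : ℕ} {Φ : MvPolynomial (Fin 2) K} (hΦ : Φ.IsHomogeneous e)
    (A : Fin 2 → MvPolynomial (Fin 2) K) (hA : ∀ i, (A i).IsHomogeneous 1) :
    (bind₁ A Φ).IsHomogeneous e := by
  have h := hΦ.eval₂ (C : K →+* MvPolynomial (Fin 2) K) A (fun r => isHomogeneous_C _ r) hA
  rw [one_mul] at h
  exact h

/-- Killing `Z` on a form of degree `e` leaves `g₀ · W^e`, `g₀` the coefficient of `W^e`. -/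
theorem bind₁_killZ_of_isHomogeneous {e : ℕ} {g : MvPolynomial (Fin 2) K} (hg : g.IsHomogeneous e) :
    bind₁ ![(0 : MvPolynomial (Fin 2) K), X 1] g = C (coeff (Finsupp.single 1 e) g) * X 1 ^ e := by
  classical
  conv_lhs => rw [g.as_sum]
  rw [map_sum]
  have hterm : ∀ m ∈ g.support, bind₁ ![(0 : MvPolynomial (Fin 2) K), X 1] (monomial m (coeff m g)) =
      if m = Finsupp.single 1 e then C (coeff (Finsupp.single 1 e) g) * X 1 ^ e else 0 := by
    intro m hm
    have hdeg : m 0 + m 1 = e := by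
      have h := hg (mem_support_iff.mp hm)
      simpa [Finsupp.weight_apply, Finsupp.sum_fintype, Fin.sum_univ_two] using h
    rw [bind₁_monomial]
    by_cases h0 : m 0 = 0
    · have hm1 : m = Finsupp.single 1 e := by
        ext i
        fin_cases i
        · simp [h0]
        · simp; omega
      subst hm1
      rw [if_pos rfl]
      by_cases he : e = 0
      · subst he
        simp
      · rw [Finsupp.support_single _ he]
        simp
    · have hne : m ≠ Finsupp.single 1 e := by
        intro h; rw [h] at h0; simp at h0
      rw [if_neg hne]
      have h0mem : (0 : Fin 2) ∈ m.support := Finsupp.mem_support_iff.mpr h0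
      rw [← Finset.mul_prod_erase _ _ h0mem]
      simp [zero_pow h0]
  rw [Finset.sum_congr rfl hterm, Finset.sum_ite_eq']
  split_ifs with hmem
  · rfl
  · rw [notMem_support_iff.mp hmem, C_0, zero_mul]

/-- Dehomogenisation `Z ↦ 1` reads off the coefficients of a form: the coefficient of `W^k` in `h(1, W)` is
the coefficient of `Z^{e-k} W^k` in `h`, for `h` homogeneous of degree `e` and `k ≤ e`. -/
theorem coeff_bind₁_oneZ_of_isHomogeneous {e : ℕ} {h : MvPolynomial (Fin 2) K} (hh : h.IsHomogeneous e)
    {k : ℕ} (hk : k ≤ e) :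
    coeff (Finsupp.single 1 k) (bind₁ ![(1 : MvPolynomial (Fin 2) K), X 1] h) =
      coeff (Finsupp.single 0 (e - k) + Finsupp.single 1 k) h := by
  classical
  set mk : Fin 2 →₀ ℕ := Finsupp.single 0 (e - k) + Finsupp.single 1 k with hmk
  conv_lhs => rw [h.as_sum]
  rw [map_sum, coeff_sum]
  have hterm : ∀ m ∈ h.support, coeff (Finsupp.single 1 k)
      (bind₁ ![(1 : MvPolynomial (Fin 2) K), X 1] (monomial m (coeff m h))) =
      if m = mk then coeff mk h else 0 := by
    intro m hm
    have hdeg : m 0 + m 1 = e := by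
      have h' := hh (mem_support_iff.mp hm)
      simpa [Finsupp.weight_apply, Finsupp.sum_fintype, Fin.sum_univ_two] using h'
    have hval : bind₁ ![(1 : MvPolynomial (Fin 2) K), X 1] (monomial m (coeff m h)) =
        C (coeff m h) * X 1 ^ (m 1) := by
      rw [bind₁_monomial]
      rw [Finset.prod_subset (Finset.subset_univ m.support) (fun i _ hi => by
        rw [Finsupp.notMem_support_iff.mp hi, pow_zero])]
      simp [Fin.prod_univ_two]
    rw [hval, coeff_C_mul, coeff_X_pow]
    by_cases hm1 : m 1 = k
    · have hmeq : m = mk := by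
        ext i; fin_cases i
        · simp [hmk]; omega
        · simp [hmk, hm1]
      rw [if_pos (by rw [hm1]), if_pos hmeq, hmeq, mul_one]
    · have hne : Finsupp.single (1 : Fin 2) (m 1) ≠ Finsupp.single 1 k :=
        fun h' => hm1 (Finsupp.single_injective _ h')
      have hmne : m ≠ mk := by
        intro h'; apply hm1; rw [h', hmk]; simp
      rw [if_neg hne, if_neg hmne, mul_zero]
  rw [Finset.sum_congr rfl hterm, Finset.sum_ite_eq']
  split_ifs with hmem
  · rfl
  · rw [notMem_support_iff.mp hmem]

/-- Dehomogenisation is injective on forms of a fixed degree: `h(1, W) = 0 ⇒ h = 0`. -/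
theorem eq_zero_of_bind₁_oneZ_eq_zero {e : ℕ} {h : MvPolynomial (Fin 2) K} (hh : h.IsHomogeneous e)
    (h0 : bind₁ ![(1 : MvPolynomial (Fin 2) K), X 1] h = 0) : h = 0 := by
  classical
  ext m
  rw [coeff_zero]
  by_contra hm
  have hdeg : m 0 + m 1 = e := by
    have h' := hh hm
    simpa [Finsupp.weight_apply, Finsupp.sum_fintype, Fin.sum_univ_two] using h'
  have hk : m 1 ≤ e := by omega
  have hc := coeff_bind₁_oneZ_of_isHomogeneous hh hk
  rw [h0, coeff_zero] at hc
  have hmeq : Finsupp.single 0 (e - m 1) + Finsupp.single 1 (m 1) = m := by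
    ext i; fin_cases i
    · simp; omega
    · simp
  rw [hmeq] at hc
  exact hm hc.symm

/-- A form invariant under `Z ↦ Z + 1` is a multiple of `W^e`. -/
theorem eq_C_mul_X_pow_of_invariant_oneZero {e : ℕ} {g : MvPolynomial (Fin 2) K}
    (hg : g.IsHomogeneous e) (hinv : bind₁ ![X 0 + 1, X 1] g = g) :
    g = C (coeff (Finsupp.single 1 e) g) * X 1 ^ e := by
  -- kill `Z` on both sides of the invariance: `g(1, W) = g(0, W) = g₀ W^e`
  have hE : bind₁ ![(1 : MvPolynomial (Fin 2) K), X 1] g =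
      C (coeff (Finsupp.single 1 e) g) * X 1 ^ e := by
    have h := congrArg (bind₁ ![(0 : MvPolynomial (Fin 2) K), X 1]) hinv
    rw [bind₁_bind₁, bind₁_killZ_of_isHomogeneous hg] at h
    have hfun : (fun i => bind₁ ![(0 : MvPolynomial (Fin 2) K), X 1] ((![X 0 + 1, X 1] : Fin 2 → _) i)) =
        ![(1 : MvPolynomial (Fin 2) K), X 1] := by
      funext i; fin_cases i <;> simp
    rw [hfun] at h
    exact h
  -- `g - g₀ W^e` is a form of degree `e` killed by dehomogenisation
  set g₀ := coeff (Finsupp.single 1 e) g with hg₀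
  have hdiff : (g - C g₀ * X 1 ^ e).IsHomogeneous e := hg.sub (isHomogeneous_C_mul_X_pow g₀ 1 e)
  have hzero : bind₁ ![(1 : MvPolynomial (Fin 2) K), X 1] (g - C g₀ * X 1 ^ e) = 0 := by
    rw [map_sub, hE, map_mul, bind₁_C_right, map_pow]
    simp
  have := eq_zero_of_bind₁_oneZ_eq_zero hdiff hzero
  exact sub_eq_zero.mp this

/-- **Translation-invariant forms, first coordinate non-zero.** If `Φ(Z + t₁, W + t₂) = Φ(Z, W)` with
`t₁ ≠ 0`, then `Φ = c·(t₂ Z − t₁ W)^e`. -/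
theorem eq_C_mul_linearPow_of_invariant_of_ne_zero {e : ℕ} {Φ : MvPolynomial (Fin 2) K}
    (hΦ : Φ.IsHomogeneous e) {t₁ t₂ : K} (ht₁ : t₁ ≠ 0)
    (hinv : bind₁ ![X 0 + C t₁, X 1 + C t₂] Φ = Φ) :
    ∃ c : K, Φ = C c * (C t₂ * X 0 - C t₁ * X 1) ^ e := by
  -- the shear `A e₁ = t`
  have hA1 : ∀ i, ((![C t₁ * X 0, C t₂ * X 0 + X 1] : Fin 2 → MvPolynomial (Fin 2) K) i).IsHomogeneous 1 := by
    intro i; fin_cases i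
    · simpa using (isHomogeneous_C_mul_X_pow t₁ (0 : Fin 2) 1)
    · have h0 : (C t₂ * X 0 : MvPolynomial (Fin 2) K).IsHomogeneous 1 := by
        simpa using (isHomogeneous_C_mul_X_pow t₂ (0 : Fin 2) 1)
      simpa using h0.add (isHomogeneous_X K (1 : Fin 2))
  have hg : (bind₁ (![C t₁ * X 0, C t₂ * X 0 + X 1] : (Fin 2 → MvPolynomial (Fin 2) K)) Φ).IsHomogeneous e :=
    isHomogeneous_bind₁_linear hΦ _ hA1
  -- `g := Φ ∘ A` is invariant under `Z ↦ Z + 1`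
  have hTA : (fun i => bind₁ (![X 0 + 1, X 1] : (Fin 2 → MvPolynomial (Fin 2) K))
      ((![C t₁ * X 0, C t₂ * X 0 + X 1] : (Fin 2 → MvPolynomial (Fin 2) K)) i)) =
      (fun i => bind₁ (![C t₁ * X 0, C t₂ * X 0 + X 1] : (Fin 2 → MvPolynomial (Fin 2) K))
      ((![X 0 + C t₁, X 1 + C t₂] : (Fin 2 → MvPolynomial (Fin 2) K)) i)) := by
    funext i; fin_cases i
    · simp only [Fin.zero_eta, Matrix.cons_val_zero, map_mul, map_add, bind₁_C_right, bind₁_X_right]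
      ring
    · simp only [Fin.mk_one, Matrix.cons_val_one, Matrix.cons_val_zero, map_mul, map_add,
        bind₁_C_right, bind₁_X_right]
      ring
  have hginv : bind₁ (![X 0 + 1, X 1] : (Fin 2 → MvPolynomial (Fin 2) K))
      (bind₁ (![C t₁ * X 0, C t₂ * X 0 + X 1] : (Fin 2 → MvPolynomial (Fin 2) K)) Φ) =
      bind₁ (![C t₁ * X 0, C t₂ * X 0 + X 1] : (Fin 2 → MvPolynomial (Fin 2) K)) Φ := by
    rw [bind₁_bind₁, hTA, ← bind₁_bind₁, hinv]
  have hgW := eq_C_mul_X_pow_of_invariant_oneZero hg hginv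
  set g₀ := coeff (Finsupp.single 1 e) (bind₁ (![C t₁ * X 0, C t₂ * X 0 + X 1] : (Fin 2 → MvPolynomial (Fin 2) K)) Φ) with hg₀
  -- undo the shear: `A⁻¹ : Z ↦ Z / t₁`, `W ↦ W − (t₂ / t₁) Z`
  have hBA : (fun i => bind₁ (![C t₁⁻¹ * X 0, X 1 - C (t₂ * t₁⁻¹) * X 0] : (Fin 2 → MvPolynomial (Fin 2) K))
      ((![C t₁ * X 0, C t₂ * X 0 + X 1] : (Fin 2 → MvPolynomial (Fin 2) K)) i)) = X := by
    funext i; fin_cases i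
    · simp only [Fin.zero_eta, Matrix.cons_val_zero, map_mul, bind₁_C_right, bind₁_X_right]
      rw [← mul_assoc, ← C_mul, mul_inv_cancel₀ ht₁, C_1, one_mul]
    · simp only [Fin.mk_one, Matrix.cons_val_one, Matrix.cons_val_zero, map_add, map_mul,
        bind₁_C_right, bind₁_X_right]
      ring
  have hΦg : Φ = bind₁ (![C t₁⁻¹ * X 0, X 1 - C (t₂ * t₁⁻¹) * X 0] : (Fin 2 → MvPolynomial (Fin 2) K))
      (bind₁ (![C t₁ * X 0, C t₂ * X 0 + X 1] : (Fin 2 → MvPolynomial (Fin 2) K)) Φ) := by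
    rw [bind₁_bind₁, hBA]
    exact (DFunLike.congr_fun bind₁_X_left Φ).symm
  refine ⟨g₀ * (-t₁⁻¹) ^ e, ?_⟩
  rw [hΦg, hgW, map_mul, bind₁_C_right, map_pow, bind₁_X_right]
  simp only [Matrix.cons_val_one, Matrix.cons_val_zero]
  have hcc : (C t₁⁻¹ * C t₁ : MvPolynomial (Fin 2) K) = 1 := by
    rw [← C_mul, inv_mul_cancel₀ ht₁, C_1]
  have hB1 : (X 1 - C (t₂ * t₁⁻¹) * X 0 : MvPolynomial (Fin 2) K) =
      C (-t₁⁻¹) * (C t₂ * X 0 - C t₁ * X 1) := by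
    rw [C_mul, C_neg]
    linear_combination (-(X 1 : MvPolynomial (Fin 2) K)) * hcc
  rw [hB1, mul_pow, ← mul_assoc, ← C_pow, ← C_mul]

/-- **Translation-invariant binary forms are powers of the invariant linear form** (memo §11 SUBLEMMA; any
field, any characteristic): if `Φ ∈ K[Z, W]` is homogeneous of degree `e` and
`Φ(Z + t₁, W + t₂) = Φ(Z, W)` for a vector `(t₁, t₂) ≠ 0`, then `Φ = c·(t₂ Z − t₁ W)^e` for some `c ∈ K`.
OURS. -/
theorem eq_C_mul_linearPow_of_translation_invariant {e : ℕ} {Φ : MvPolynomial (Fin 2) K}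
    (hΦ : Φ.IsHomogeneous e) {t₁ t₂ : K} (ht : t₁ ≠ 0 ∨ t₂ ≠ 0)
    (hinv : bind₁ ![X 0 + C t₁, X 1 + C t₂] Φ = Φ) :
    ∃ c : K, Φ = C c * (C t₂ * X 0 - C t₁ * X 1) ^ e := by
  by_cases ht₁ : t₁ = 0
  · have ht₂ : t₂ ≠ 0 := ht.resolve_left (not_not.mpr ht₁)
    -- swap the variables and use the first case
    have hS1 : ∀ i, ((![X 1, X 0] : Fin 2 → MvPolynomial (Fin 2) K) i).IsHomogeneous 1 := by
      intro i; fin_cases i <;> simpa using isHomogeneous_X K _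
    have hΦ'h : (bind₁ (![X 1, X 0] : (Fin 2 → MvPolynomial (Fin 2) K)) Φ).IsHomogeneous e := isHomogeneous_bind₁_linear hΦ _ hS1
    have hTS : (fun i => bind₁ (![X 0 + C t₂, X 1 + C t₁] : (Fin 2 → MvPolynomial (Fin 2) K)) ((![X 1, X 0] : (Fin 2 → MvPolynomial (Fin 2) K)) i)) =
        (fun i => bind₁ (![X 1, X 0] : (Fin 2 → MvPolynomial (Fin 2) K)) ((![X 0 + C t₁, X 1 + C t₂] : (Fin 2 → MvPolynomial (Fin 2) K)) i)) := by
      funext i; fin_cases i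
      · simp only [Fin.zero_eta, Matrix.cons_val_zero, Matrix.cons_val_one, map_add, bind₁_C_right,
          bind₁_X_right]
      · simp only [Fin.mk_one, Matrix.cons_val_one, Matrix.cons_val_zero, map_add, bind₁_C_right,
          bind₁_X_right]
    have hinv' : bind₁ (![X 0 + C t₂, X 1 + C t₁] : (Fin 2 → MvPolynomial (Fin 2) K)) (bind₁ (![X 1, X 0] : (Fin 2 → MvPolynomial (Fin 2) K)) Φ) =
        bind₁ (![X 1, X 0] : (Fin 2 → MvPolynomial (Fin 2) K)) Φ := by
      rw [bind₁_bind₁, hTS, ← bind₁_bind₁, hinv]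
    obtain ⟨c, hc⟩ := eq_C_mul_linearPow_of_invariant_of_ne_zero hΦ'h ht₂ hinv'
    have hSS : (fun i => bind₁ (![X 1, X 0] : (Fin 2 → MvPolynomial (Fin 2) K)) ((![X 1, X 0] : (Fin 2 → MvPolynomial (Fin 2) K)) i)) = X := by
      funext i; fin_cases i
      · simp only [Fin.zero_eta, Matrix.cons_val_zero, Matrix.cons_val_one, bind₁_X_right]
      · simp only [Fin.mk_one, Matrix.cons_val_one, Matrix.cons_val_zero, bind₁_X_right]
    have hback : Φ = bind₁ (![X 1, X 0] : (Fin 2 → MvPolynomial (Fin 2) K)) (bind₁ (![X 1, X 0] : (Fin 2 → MvPolynomial (Fin 2) K)) Φ) := by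
      rw [bind₁_bind₁, hSS]
      exact (DFunLike.congr_fun bind₁_X_left Φ).symm
    refine ⟨c * (-1) ^ e, ?_⟩
    rw [hback, hc, map_mul, bind₁_C_right, map_pow, map_sub, map_mul, map_mul, bind₁_C_right,
      bind₁_C_right, bind₁_X_right, bind₁_X_right]
    simp only [Matrix.cons_val_zero, Matrix.cons_val_one]
    rw [show (C t₁ * X 1 - C t₂ * X 0 : MvPolynomial (Fin 2) K) = C (-1) * (C t₂ * X 0 - C t₁ * X 1) by
      rw [C_neg, C_1]; ring]
    rw [mul_pow, ← mul_assoc, ← C_pow, ← C_mul]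
  · exact eq_C_mul_linearPow_of_invariant_of_ne_zero hΦ ht₁ hinv

/-- **K-β7 step (4) closer** (memo §12.3 (4) + §12.4): `κ ⊆ L` fields, `char κ = 2`, `Ψ ∈ κ[Z, W]`
homogeneous of odd degree `d` and anisotropic over `κ`; if both partial derivatives of `Ψ ⊗ L` are invariant
under the translation by a non-zero vector `(t₁, t₂) ∈ L²`, then `False`. OURS. -/
theorem false_of_pderiv_translation_invariant {κ L : Type*} [Field κ] [Field L] [Algebra κ L] [CharP κ 2]
    {d : ℕ} (hd : Odd d) {Ψ : MvPolynomial (Fin 2) κ} (hΨ : Ψ.IsHomogeneous d)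
    (han : ∀ a b : κ, (a ≠ 0 ∨ b ≠ 0) → eval ![a, b] Ψ ≠ 0)
    (t₁ t₂ : L) (ht : t₁ ≠ 0 ∨ t₂ ≠ 0)
    (h0 : bind₁ ![X 0 + C t₁, X 1 + C t₂] (pderiv 0 (map (algebraMap κ L) Ψ)) =
      pderiv 0 (map (algebraMap κ L) Ψ))
    (h1 : bind₁ ![X 0 + C t₁, X 1 + C t₂] (pderiv 1 (map (algebraMap κ L) Ψ)) =
      pderiv 1 (map (algebraMap κ L) Ψ)) : False := by
  haveI : CharP L 2 := charP_of_injective_algebraMap (algebraMap κ L).injective 2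
  have hhom : ∀ i : Fin 2, (pderiv i (map (algebraMap κ L) Ψ)).IsHomogeneous (d - 1) :=
    fun i => (hΨ.map (algebraMap κ L)).pderiv
  obtain ⟨α, hα⟩ := eq_C_mul_linearPow_of_translation_invariant (hhom 0) ht h0
  obtain ⟨β, hβ⟩ := eq_C_mul_linearPow_of_translation_invariant (hhom 1) ht h1
  have hℓ : (C t₂ * X 0 - C t₁ * X 1 : MvPolynomial (Fin 2) L) = C t₂ * X 0 + C t₁ * X 1 :=
    CharTwo.sub_eq_add _ _
  rw [hℓ] at hα hβ
  exact OddAnisotropic.false_of_pderiv_eq_linearPow hd hΨ han t₁ t₂ ht α β hα hβ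

end Summit.ResolutionOfSingularities.ResolutionOfSingularities.Theorems.SwitchingDichotomy.TranslationInvariant
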